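import Summits.QuantumFields.BalabanUV.T4Continuum.Support.NE7SliceIterationState
import Summits.QuantumFields.BalabanUV.T4Continuum.Support.NE7SliceGaugeFunctionSized
import Summits.QuantumFields.BalabanUV.T4Continuum.Support.NE7GaugeFunctionSupLetter
import Summits.QuantumFields.BalabanUV.T4Continuum.Support.NE7TangentTransportGauge
import Summits.QuantumFields.BalabanUV.T4Continuum.Support.NE3LandauOrbit
import Summits.QuantumFields.BalabanUV.T4Continuum.Support.NE3SmoothLiftW
import Summits.QuantumFields.BalabanUV.T4Continuum.Support.NE3FramePotBoundW
import Summits.QuantumFields.BalabanUV.T4Continuum.Support.AveragingDeficitKDatum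
import Summits.QuantumFields.BalabanUV.T4Continuum.Support.BlockAverageLogInteraction
import Literature.MathematicalPhysics.QuantumFieldTheory.Balaban1983to89.T4TermwiseUN
import HarnessLib

/-!
# NE7SliceIterationStateFacts — THE STATE MAPS OF THE (S1) ITERATION ON THE WORKING REGION (memo ROAD-G100 §2.7 item F4, second file): skewness and periodicity of `X(u)`, `h(u)`, `φ(u)`,
# `T(u)`; exactness `dirIter T(u) = gaugeDir_V h(u)`; EXISTENCE of the normalised split (so the chosen `ζ(u)`, `Ỹ(u)` of `NE7SliceIterationState` ARE a split); the access letters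
# `‖framePotW T(u) − h(u)‖ ≤ m(u)`, `‖gaugeDir W ζ(u)‖ ≤ δ(u)`, and THE GAUGE FUNCTION IS SIZED BY THE DEFECT: `‖ζ(u)‖ ≤ 6dM·Df(u)` (Poincaré parameter `θ_P ≤ 1∕2`)

Cell `pub-balaban`, rung (B)+1 sub-cell t4, lineage `b2b-balaban-t4-ne7-p1`, generation 101 (CRUX PROVER NE7 #1 = OWNER of BINDER row NE7).  Memo `t4/b2b-balaban-t4-ne7-p1-g101/ROAD-G101.md` §7.
WORKING REGION of a state `u` (a site gauge): `u` unitary and `(tower L N (k+1))`-periodic, the chart condition `U′^{u} = W·e^{X(u)}` (`gaugeAct u U′ = vary W X(u) 1`) with `‖X(u)‖ ≤ 1∕8`, the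
corner condition `u(M•z) = e^{h(u) z}` with `‖h(u)‖ ≤ 1∕8`; `W`, `U′` unitary `(tower)`-periodic, `W` in the multi-level small-field class with `cruxC·M²x < 1`.
WHAT ([folklore]; 0 def, 0 sorry).
§1 `repLog_skew`, `repLog_periodic`, `cornerLog_skew`, `cornerLog_periodic`, `coarseDatum_skew_periodic`, `tangentPart_skew`, `tangentPart_periodic`, **`dirIter_tangentPart`** (`= gaugeDir_V h(u)`).
§2 **`split_exists`** (`NE7SliceGaugeFunctionSized.exists_fullGauge_split_sized`), `frame_periodic`, **`norm_frame_le_frameMismatch`**, **`norm_gaugeDir_gaugeFun_le`**, `delta_le_sliceDefect`,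
   `frameMismatch_le_sliceDefect`, **`norm_gaugeFun_le`** (`‖ζ(u) y‖ ≤ 6dM·Df(u)` for `θ_P ≤ 1∕2`, via `NE7GaugeFunctionSupLetter.sup_le_of_bmeanIterW_le` — any representative).
HONEST FRAMING (page 1): bookkeeping over landed letters; nothing of Bałaban's asserted; NOT the one-step contraction in state form (next file), NOT (S1), NOT NE7; spine 0∕9; finite T⁴ rung (B)+1 —
NOT infinite volume, NOT mass gap, NOT BetaPertH, NOT Clay.  Continuum YM on T⁴ ⇐ BetaPertH ∧ nine spine estimates (0/9 proved); BetaPertH ⇐ (D1) ∧ (D4) ∧ CAP+tail; G-an2-4 gates asym,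
D1 and NE2/3/4.
-/

set_option autoImplicit false

open scoped BigOperators Matrix.Norms.L2Operator
open NormedSpace Finset

namespace Summit.QuantumFields.BalabanUV.T4Continuum.NE7SliceIterationStateFacts

open Literature.MathematicalPhysics.QuantumFieldTheory.Balaban1983to89
open B7Prop1Explicit B7Prop2Explicit MatrixLog
open T4AveragingDeficitWall (IsUnitaryCfg IsSkewDir SmallField vary)
open T4AveragingDeficitWallBoundary (IsPeriodicCfg periodBox)
open T4TermwiseUN (mlog_skew)
open AveragingDeficitPeriodicCounting (IsPeriodicDir)
open AveragingDeficitTwoLevelPrep (prop1Radius)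
open AveragingDeficitMultiLevelPrep (cavgIter LevelSmall tower isPeriodicCfg_cavgIter cavgIter_unitary_small)
open AveragingDeficitKDatum (isUnitaryCfg_gaugeAct)
open BlockAveragePushDirGauge (gaugeDir isPeriodicDir_gaugeDir)
open BlockAverageLogInteraction (norm_exp_sub_one_le_two_mul)
open NE3EnergyShapes (IsUnitarySite IsPeriodicSite)
open NE3TangentCovariantTower (dirIter framePotW)
open NE3ResidualSliceRep (dirIter_sub isPeriodicCfg_gaugeAct)
open NE3CovariantBlockMean (bmeanIterW)
open NE3QbarIterCovLiftPrep (cruxC)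
open NE3SmoothRightInverseW (rightInvW dirIter_rightInvW isSkewDir_rightInvW isPeriodicDir_rightInvW)
open NE3SmoothLiftW (framePotW_add_period)
open NE3FramePotBoundW (tower_eq_pow_mul)
open NE3LandauOrbit (gaugeDir_skew)
open NE7TangentTransportGauge (dirIter_skew_periodic)
open NE7MeanZeroGaugeSliceW (energyBlockLandauW)
open NE7SliceGaugeFunctionSized (exists_fullGauge_split_sized)
open NE7GaugeFunctionSupLetter (sup_le_of_bmeanIterW_le)
open SpreadLift (loopRad)
open NE7SliceIterationState

noncomputable section

variable {d : ℕ} {n : Type*} [Fintype n] [DecidableEq n]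

/-! ## §1 Skewness, periodicity, exactness of the state maps -/

section Facts

variable [Nonempty n] {L : ℕ} (hL : 2 ≤ L) (k : ℕ) {W : Site d → Fin d → (Matrix n n ℂ)ˣ} {x : ℝ} (hWu : IsUnitaryCfg W) (hx : 0 ≤ x) (hs : LevelSmall d L k x)
  (hWx : SmallField W x) (N : ℕ) [NeZero N] (hθ : cruxC d L * (((L : ℝ) ^ (k + 1)) ^ 2 * x) < 1) (U' : Site d → Fin d → (Matrix n n ℂ)ˣ)
  (hWP : IsPeriodicCfg W ((tower L N (k + 1) : ℕ) : ℤ)) (hU'u : IsUnitaryCfg U') (hU'P : IsPeriodicCfg U' ((tower L N (k + 1) : ℕ) : ℤ))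
  {u : Site d → (Matrix n n ℂ)ˣ} (hu : IsUnitarySite u) (huP : IsPeriodicSite u ((tower L N (k + 1) : ℕ) : ℤ))
  (hgauge : gaugeAct u U' = vary W (repLog W U' u) 1) (hXs : ∀ y κ, ‖repLog W U' u y κ‖ ≤ 1 / 8)
  (hcorner : ∀ z, ((u (((L : ℤ) ^ (k + 1)) • z) : (Matrix n n ℂ)ˣ) : Matrix n n ℂ) = exp (cornerLog L k u z)) (hhs : ∀ z, ‖cornerLog L k u z‖ ≤ 1 / 8)

include hWu hU'u hu hgauge hXs in
/-- **`X(u)` IS SKEW** on the working region (`W⁻¹U′^{u} = e^{X(u)}` is unitary within `1∕4` of `1`). [folklore] -/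
theorem repLog_skew : IsSkewDir (repLog W U' u) := by
  intro y κ
  have hA : (W y κ)⁻¹ * gaugeAct u U' y κ ∈ unitaryUnits (Matrix n n ℂ) :=
    (unitaryUnits _).mul_mem ((unitaryUnits _).inv_mem (hWu y κ)) (isUnitaryCfg_gaugeAct hu hU'u y κ)
  have hval : (((W y κ)⁻¹ * gaugeAct u U' y κ : (Matrix n n ℂ)ˣ) : Matrix n n ℂ) = exp (repLog W U' u y κ) := by
    have hg := congrFun (congrFun hgauge y) κ
    rw [hg, vary, ← mul_assoc, inv_mul_cancel, one_mul, val_expUnit, Complex.ofReal_one, one_smul]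
  have hnear : ‖(((W y κ)⁻¹ * gaugeAct u U' y κ : (Matrix n n ℂ)ˣ) : Matrix n n ℂ) - 1‖ ≤ 1 / 4 := by
    rw [hval]
    exact (norm_exp_sub_one_le_two_mul (hXs y κ) (by norm_num)).1.trans (by norm_num)
  have h := mlog_skew hA hnear
  rw [Units.val_mul] at h
  exact skewAdjoint.mem_iff.mpr h

omit [Nonempty n] [NeZero N] in
include hWP hU'P huP in
/-- **`X(u)` IS `(tower)`-PERIODIC** (all data periodic). [folklore] -/
theorem repLog_periodic : IsPeriodicDir (repLog W U' u) ((tower L N (k + 1) : ℕ) : ℤ) := by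
  intro y i μ
  simp only [repLog, hWP y i μ, isPeriodicCfg_gaugeAct huP hU'P y i μ]

include hu hcorner hhs in
/-- **`h(u)` IS SKEW** on the working region (`u(M•z) = e^{h(u) z}` unitary within `1∕4` of `1`). [folklore] -/
theorem cornerLog_skew (z : Site d) : cornerLog L k u z ∈ skewAdjoint (Matrix n n ℂ) := by
  have hnear : ‖((u (((L : ℤ) ^ (k + 1)) • z) : (Matrix n n ℂ)ˣ) : Matrix n n ℂ) - 1‖ ≤ 1 / 4 := by
    rw [hcorner z]
    exact (norm_exp_sub_one_le_two_mul (hhs z) (by norm_num)).1.trans (by norm_num)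
  exact skewAdjoint.mem_iff.mpr (mlog_skew (hu _) hnear)

omit [Nonempty n] [NeZero N] in
include huP in
/-- **`h(u)` IS `N`-PERIODIC** (`u` is `(M·N)`-periodic, `M = L^{k+1}`). [folklore] -/
theorem cornerLog_periodic (z : Site d) (i : Fin d) : cornerLog L k u (z + (N : ℤ) • e i) = cornerLog L k u z := by
  have hT : ((tower L N (k + 1) : ℕ) : ℤ) = ((L : ℤ) ^ (k + 1)) * (N : ℤ) := by
    rw [tower_eq_pow_mul]; push_cast; ring
  have e1 : ((L : ℤ) ^ (k + 1)) • (z + (N : ℤ) • e i) = ((L : ℤ) ^ (k + 1)) • z + ((tower L N (k + 1) : ℕ) : ℤ) • e i := by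
    rw [smul_add, smul_smul, hT]
  simp only [cornerLog, e1, huP _ i]

include hL hWu hx hs hWx hWP hU'u hU'P hu huP hgauge hXs hcorner hhs in
/-- **`φ(u)` IS SKEW AND `N`-PERIODIC** on the working region. [folklore] -/
theorem coarseDatum_skew_periodic : IsSkewDir (coarseDatum L k W U' u) ∧ IsPeriodicDir (coarseDatum L k W U' u) (N : ℤ) := by
  have hL1 : 1 ≤ L := by omega
  have hX := dirIter_skew_periodic hL1 k hWu hWP hx hs hWx (repLog_skew hWu U' hU'u hu hgauge hXs) (repLog_periodic k N U' hWP hU'P huP)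
  have hVu : IsUnitaryCfg (cavgIter L (k + 1) W) := (cavgIter_unitary_small hL1 k hWu hx hs hWx).1
  have hVP : IsPeriodicCfg (cavgIter L (k + 1) W) (N : ℤ) := isPeriodicCfg_cavgIter L N (k + 1) hWP
  have hg := gaugeDir_skew hVu (cornerLog_skew k hu hcorner hhs)
  have hgP := isPeriodicDir_gaugeDir hVP (cornerLog_periodic k N huP)
  exact ⟨fun z κ => (skewAdjoint _).sub_mem (hX.1 z κ) (hg z κ), fun z i κ => by simp only [coarseDatum, hX.2 z i κ, hgP z i κ]⟩

include hWP hU'u hU'P hu huP hgauge hXs hcorner hhs in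
/-- **`T(u)` IS SKEW** on the working region. [folklore] -/
theorem tangentPart_skew : IsSkewDir (tangentPart hL k hWu hx hs hWx N hθ U' u) := by
  have hφ := (coarseDatum_skew_periodic hL k hWu hx hs hWx N U' hWP hU'u hU'P hu huP hgauge hXs hcorner hhs).1
  intro y κ
  simp only [tangentPart, normalPart_eq hL k hWu hx hs hWx N hθ U' hφ]
  exact (skewAdjoint _).sub_mem (repLog_skew hWu U' hU'u hu hgauge hXs y κ) (isSkewDir_rightInvW hL k hWu hx hs hWx hθ hφ y κ)

include hWP hU'u hU'P hu huP hgauge hXs hcorner hhs in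
/-- **`T(u)` IS `(tower)`-PERIODIC** on the working region. [folklore] -/
theorem tangentPart_periodic : IsPeriodicDir (tangentPart hL k hWu hx hs hWx N hθ U' u) ((tower L N (k + 1) : ℕ) : ℤ) := by
  have hφ := (coarseDatum_skew_periodic hL k hWu hx hs hWx N U' hWP hU'u hU'P hu huP hgauge hXs hcorner hhs).1
  intro y i μ
  simp only [tangentPart, normalPart_eq hL k hWu hx hs hWx N hθ U' hφ, repLog_periodic k N U' hWP hU'P huP y i μ,
    isPeriodicDir_rightInvW hL k hWu hWP hx hs hWx hθ hφ y i μ]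

include hWP hU'u hU'P hu huP hgauge hXs hcorner hhs in
/-- **`dirIter T(u) = gaugeDir_V h(u)`** on the working region (`rightInvW` is an exact right inverse). [folklore] -/
theorem dirIter_tangentPart : dirIter L (k + 1) W (tangentPart hL k hWu hx hs hWx N hθ U' u) = gaugeDir (cavgIter L (k + 1) W) (cornerLog L k u) := by
  have hL1 : 1 ≤ L := by omega
  have hφ := coarseDatum_skew_periodic hL k hWu hx hs hWx N U' hWP hU'u hU'P hu huP hgauge hXs hcorner hhs
  have e : tangentPart hL k hWu hx hs hWx N hθ U' u = fun y κ => repLog W U' u y κ - rightInvW hL k hWu hx hs hWx N hθ hφ.1 y κ := by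
    funext y κ; simp only [tangentPart, normalPart_eq hL k hWu hx hs hWx N hθ U' hφ.1]
  rw [e, dirIter_sub hL1 k hWu hx hs hWx, dirIter_rightInvW hL k hWu hWP hx hs hWx hθ hφ.1 hφ.2]
  funext z κ
  simp only [coarseDatum, sub_sub_cancel]

/-! ## §2 The split exists; access letters; the gauge function is sized by the defect -/

include hWP hU'u hU'P hu huP hgauge hXs hcorner hhs in
/-- **THE NORMALISED SPLIT OF `(T(u), h(u))` EXISTS** on the working region. [folklore] -/
theorem split_exists : ∃ p : (Site d → Matrix n n ℂ) × (Site d → Fin d → Matrix n n ℂ),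
    IsNormalisedSplit L k N W (tangentPart hL k hWu hx hs hWx N hθ U' u) (cornerLog L k u) p.1 p.2 := by
  obtain ⟨ζ, Y, hζs, hζP, hY, hsplit, hmean, -⟩ := exists_fullGauge_split_sized hL k hWu hWP hx hs hWx
    (tangentPart_skew hL k hWu hx hs hWx N hθ U' hWP hU'u hU'P hu huP hgauge hXs hcorner hhs)
    (tangentPart_periodic hL k hWu hx hs hWx N hθ U' hWP hU'u hU'P hu huP hgauge hXs hcorner hhs)
    (cornerLog_skew k hu hcorner hhs) (cornerLog_periodic k N huP)
    (dirIter_tangentPart hL k hWu hx hs hWx N hθ U' hWP hU'u hU'P hu huP hgauge hXs hcorner hhs)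
  exact ⟨(ζ, Y), hζs, hζP, hY, hsplit, hmean⟩

include hWP hU'u hU'P hu huP hgauge hXs hcorner hhs in
/-- the chosen `(ζ(u), Ỹ(u))` IS a normalised split on the working region. [folklore] -/
theorem split_holds : IsNormalisedSplit L k N W (tangentPart hL k hWu hx hs hWx N hθ U' u) (cornerLog L k u)
    (gaugeFun hL k hWu hx hs hWx N hθ U' u) (slicePart hL k hWu hx hs hWx N hθ U' u) :=
  split_spec hL k hWu hx hs hWx N hθ U' (split_exists hL k hWu hx hs hWx N hθ U' hWP hU'u hU'P hu huP hgauge hXs hcorner hhs)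

include hWP hU'u hU'P hu huP hgauge hXs hcorner hhs in
/-- the frame mismatch integrand `z ↦ framePotW T(u) z − h(u) z` is `N`-periodic on the working region. [folklore] -/
theorem frame_periodic (z : Site d) (i : Fin d) :
    framePotW L (k + 1) W (tangentPart hL k hWu hx hs hWx N hθ U' u) (z + (N : ℤ) • e i) - cornerLog L k u (z + (N : ℤ) • e i)
      = framePotW L (k + 1) W (tangentPart hL k hWu hx hs hWx N hθ U' u) z - cornerLog L k u z := by
  rw [framePotW_add_period L k hWP (tangentPart_periodic hL k hWu hx hs hWx N hθ U' hWP hU'u hU'P hu huP hgauge hXs hcorner hhs) z i,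
    cornerLog_periodic k N huP z i]

include hWP hU'u hU'P hu huP hgauge hXs hcorner hhs in
/-- **`‖framePotW T(u) z − h(u) z‖ ≤ m(u)`** everywhere (box sup of a periodic function). [folklore] -/
theorem norm_frame_le_frameMismatch (z : Site d) :
    ‖framePotW L (k + 1) W (tangentPart hL k hWu hx hs hWx N hθ U' u) z - cornerLog L k u z‖ ≤ frameMismatch hL k hWu hx hs hWx N hθ U' u :=
  le_siteSup (Nat.one_le_iff_ne_zero.mpr (NeZero.ne N)) (f := fun z => ‖framePotW L (k + 1) W (tangentPart hL k hWu hx hs hWx N hθ U' u) z - cornerLog L k u z‖)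
    (fun x κ => by simp only [frame_periodic hL k hWu hx hs hWx N hθ U' hWP hU'u hU'P hu huP hgauge hXs hcorner hhs x κ]) z

include hWP hU'u hU'P hu huP hgauge hXs hcorner hhs in
/-- **`‖gaugeDir W ζ(u) y μ‖ ≤ δ(u) := Df(u) − m(u)∕M`** everywhere (box sup of a periodic function). [folklore] -/
theorem norm_gaugeDir_gaugeFun_le (y : Site d) (μ : Fin d) :
    ‖gaugeDir W (gaugeFun hL k hWu hx hs hWx N hθ U' u) y μ‖
      ≤ bondSup (tower L N (k + 1)) (fun y μ => ‖gaugeDir W (gaugeFun hL k hWu hx hs hWx N hθ U' u) y μ‖) := by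
  haveI : NeZero L := ⟨by omega⟩
  have hsp := split_holds hL k hWu hx hs hWx N hθ U' hWP hU'u hU'P hu huP hgauge hXs hcorner hhs
  have hP := isPeriodicDir_gaugeDir hWP hsp.2.1
  exact le_bondSup (Nat.one_le_iff_ne_zero.mpr (NeZero.ne _)) (F := fun y μ => ‖gaugeDir W (gaugeFun hL k hWu hx hs hWx N hθ U' u) y μ‖)
    (fun x κ μ => by simp only [hP x κ μ]) y μ

/-- `δ(u) ≤ Df(u)` (`m(u) ≥ 0`, `L ≥ 2`). [folklore] -/
theorem delta_le_sliceDefect (u : Site d → (Matrix n n ℂ)ˣ) :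
    bondSup (tower L N (k + 1)) (fun y μ => ‖gaugeDir W (gaugeFun hL k hWu hx hs hWx N hθ U' u) y μ‖) ≤ sliceDefect hL k hWu hx hs hWx N hθ U' u := by
  have hM : 0 < (L : ℝ) ^ (k + 1) := pow_pos (by exact_mod_cast (by omega : 0 < L)) _
  exact le_add_of_nonneg_right (div_nonneg (siteSup_nonneg fun z => norm_nonneg _) hM.le)

/-- `m(u) ≤ M·Df(u)` (`δ(u) ≥ 0`, `L ≥ 2`). [folklore] -/
theorem frameMismatch_le_sliceDefect (u : Site d → (Matrix n n ℂ)ˣ) :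
    frameMismatch hL k hWu hx hs hWx N hθ U' u ≤ (L : ℝ) ^ (k + 1) * sliceDefect hL k hWu hx hs hWx N hθ U' u := by
  have hM : 0 < (L : ℝ) ^ (k + 1) := pow_pos (by exact_mod_cast (by omega : 0 < L)) _
  have hM' : (L : ℝ) ^ (k + 1) ≠ 0 := hM.ne'
  have e : (L : ℝ) ^ (k + 1) * sliceDefect hL k hWu hx hs hWx N hθ U' u
      = (L : ℝ) ^ (k + 1) * bondSup (tower L N (k + 1)) (fun y μ => ‖gaugeDir W (gaugeFun hL k hWu hx hs hWx N hθ U' u) y μ‖)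
        + frameMismatch hL k hWu hx hs hWx N hθ U' u := by
    unfold sliceDefect; field_simp
  rw [e]
  exact le_add_of_nonneg_left (mul_nonneg hM.le (bondSup_nonneg fun y μ => norm_nonneg _))

include hWP hU'u hU'P hu huP hgauge hXs hcorner hhs in
/-- **THE GAUGE FUNCTION IS SIZED BY THE DEFECT**: for Poincaré parameter `θ_P ≤ 1∕2`, `‖ζ(u) y‖ ≤ 6dM·Df(u)` (`M = L^{k+1}`; via `sup_le_of_bmeanIterW_le` with `G := δ(u)` and
`‖bmeanIterW ζ(u)‖ = ‖framePotW T(u) − h(u)‖ ≤ m(u)`). [folklore] -/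
theorem norm_gaugeFun_le (hd : 0 < d)
    (hθP : 4 * (d : ℝ) ^ 2 * ((L : ℝ) ^ (k + 1) - 1) ^ 2 * x + 16 * d * loopRad d L ((prop1Radius d L)^[k] x)
        + 4 * d * ((d : ℝ) - 1) * ((L : ℝ) ^ (k + 1) - 1) ^ 2 * x ≤ 1 / 2) (y : Site d) :
    ‖gaugeFun hL k hWu hx hs hWx N hθ U' u y‖ ≤ 6 * d * (L : ℝ) ^ (k + 1) * sliceDefect hL k hWu hx hs hWx N hθ U' u := by
  have hsp := split_holds hL k hWu hx hs hWx N hθ U' hWP hU'u hU'P hu huP hgauge hXs hcorner hhs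
  obtain ⟨hζs, hζP, -, -, hmean⟩ := hsp
  have hm : ∀ z, ‖bmeanIterW L (k + 1) W (gaugeFun hL k hWu hx hs hWx N hθ U' u) z‖ ≤ frameMismatch hL k hWu hx hs hWx N hθ U' u := fun z => by
    rw [hmean z, norm_neg]
    exact norm_frame_le_frameMismatch hL k hWu hx hs hWx N hθ U' hWP hU'u hU'P hu huP hgauge hXs hcorner hhs z
  have hG := norm_gaugeDir_gaugeFun_le hL k hWu hx hs hWx N hθ U' hWP hU'u hU'P hu huP hgauge hXs hcorner hhs
  haveI : NeZero L := ⟨by omega⟩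
  have hP1 : 1 ≤ tower L N (k + 1) := Nat.one_le_iff_ne_zero.mpr (NeZero.ne _)
  have h := sup_le_of_bmeanIterW_le hL k hWu hx hs hWx (gaugeFun hL k hWu hx hs hWx N hθ U' u) hm hP1 hζP hG (lt_of_le_of_lt hθP (by norm_num)) y
  refine h.trans ?_
  -- `(m + 2d(M−1)δ)/(1−θ_P) ≤ 2(m + 2d(M−1)δ) ≤ 2M·Df + 4dM·Df ≤ 6dM·Df`
  obtain ⟨θP, hθPdef⟩ : ∃ t : ℝ, t = 4 * (d : ℝ) ^ 2 * ((L : ℝ) ^ (k + 1) - 1) ^ 2 * x + 16 * d * loopRad d L ((prop1Radius d L)^[k] x)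
      + 4 * d * ((d : ℝ) - 1) * ((L : ℝ) ^ (k + 1) - 1) ^ 2 * x := ⟨_, rfl⟩
  rw [← hθPdef] at hθP ⊢
  obtain ⟨M, hMdef⟩ : ∃ M : ℝ, M = (L : ℝ) ^ (k + 1) := ⟨_, rfl⟩
  rw [← hMdef]
  have hM1 : 1 ≤ M := hMdef ▸ one_le_pow₀ (by exact_mod_cast (by omega : 1 ≤ L))
  have hd1 : (1 : ℝ) ≤ d := by exact_mod_cast hd
  have hDf0 : 0 ≤ sliceDefect hL k hWu hx hs hWx N hθ U' u := sliceDefect_nonneg hL k hWu hx hs hWx N hθ U' u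
  have hδ0 : 0 ≤ bondSup (tower L N (k + 1)) (fun y μ => ‖gaugeDir W (gaugeFun hL k hWu hx hs hWx N hθ U' u) y μ‖) := bondSup_nonneg fun y μ => norm_nonneg _
  have hδ := delta_le_sliceDefect hL k hWu hx hs hWx N hθ U' u
  have hmM := frameMismatch_le_sliceDefect hL k hWu hx hs hWx N hθ U' u
  rw [← hMdef] at hmM
  have hnum0 : 0 ≤ frameMismatch hL k hWu hx hs hWx N hθ U' u
      + 2 * d * (M - 1) * bondSup (tower L N (k + 1)) (fun y μ => ‖gaugeDir W (gaugeFun hL k hWu hx hs hWx N hθ U' u) y μ‖) := by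
    have := siteSup_nonneg (P := N) (fun z => norm_nonneg (framePotW L (k + 1) W (tangentPart hL k hWu hx hs hWx N hθ U' u) z - cornerLog L k u z))
    have h2 : 0 ≤ 2 * d * (M - 1) := by nlinarith
    exact add_nonneg this (mul_nonneg h2 hδ0)
  have hden : (1 : ℝ) / 2 ≤ 1 - θP := by linarith
  calc (frameMismatch hL k hWu hx hs hWx N hθ U' u + 2 * d * (M - 1) * bondSup (tower L N (k + 1)) (fun y μ => ‖gaugeDir W (gaugeFun hL k hWu hx hs hWx N hθ U' u) y μ‖)) / (1 - θP)
      ≤ (frameMismatch hL k hWu hx hs hWx N hθ U' u + 2 * d * (M - 1) * bondSup (tower L N (k + 1)) (fun y μ => ‖gaugeDir W (gaugeFun hL k hWu hx hs hWx N hθ U' u) y μ‖)) / (1 / 2) :=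
        div_le_div_of_nonneg_left hnum0 (by norm_num) hden
    _ = 2 * frameMismatch hL k hWu hx hs hWx N hθ U' u
          + 4 * d * (M - 1) * bondSup (tower L N (k + 1)) (fun y μ => ‖gaugeDir W (gaugeFun hL k hWu hx hs hWx N hθ U' u) y μ‖) := by ring
    _ ≤ 2 * (M * sliceDefect hL k hWu hx hs hWx N hθ U' u) + 4 * d * (M - 1) * sliceDefect hL k hWu hx hs hWx N hθ U' u := by
        have h2 : 0 ≤ 4 * d * (M - 1) := by nlinarith
        nlinarith [mul_le_mul_of_nonneg_left hδ h2]
    _ ≤ 6 * d * M * sliceDefect hL k hWu hx hs hWx N hθ U' u := by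
        have h1 : M * sliceDefect hL k hWu hx hs hWx N hθ U' u ≤ d * (M * sliceDefect hL k hWu hx hs hWx N hθ U' u) :=
          le_mul_of_one_le_left (mul_nonneg (by linarith) hDf0) hd1
        have h2 : 4 * d * (M - 1) * sliceDefect hL k hWu hx hs hWx N hθ U' u ≤ 4 * d * M * sliceDefect hL k hWu hx hs hWx N hθ U' u := by
          nlinarith [mul_nonneg (by linarith : (0 : ℝ) ≤ d) hDf0]
        nlinarith [h1, h2]

end Facts

end

end Summit.QuantumFields.BalabanUV.T4Continuum.NE7SliceIterationStateFacts
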